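import Summits.QuantumFields.YangMills.Theorems.LuscherReductionTwistedTraceScalingShellLogAssembly
import HarnessLib

/-!
# R3 — THE TWO-ZONE COMPOSITION WITH LOG RATE: `ValleyGainLogAt L δc η` ⟸ `InnerShellGainSmallLogAt L δc δ η` + `ValleyGainLogAt L δ η`
# (lane A of S-BASE, crux `TwistedTraceScaling` stmt-QuantumFields-20203, line «twolattice», stub `stub_fixedLatticeTraceLaw`; hand A for lead g24; card `Lines-window-floor.md` §3 R3)

The log-rate twin of ✓`valleyGainAt_of_shellSmall` (✓`…InnerTwoZone` §4): cut a valley function `φ` at the admissible IMS radius `δ` (✓`qform_le_inner_outer_lat`); the `cos`-piece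
lives in the small-action shell (action bound inherited from `φ`), the `sin`-piece in the old valley; both gains are taken at log rate `c + 1`, which is below the rate
`(c·log β + 1)·λ_b` once `log β ≥ 1`; the cut costs `≤ (λ_b/4)·λ₀‖φ‖²` through the β-uniform floor (✓`levelValue_zero_ge_uniform`, `onionErr ≤ λ_b/4` eventually), and the
margin `e^{−(c log β)λ_b} − e^{−(c log β + 1)λ_b} ≥ λ_b/4` holds because `(c·log β)·λ_b(L³β) ≤ 1/2` eventually (R1 ✓`log_mul_bareLambda_le_of_pos`) and `λ_b ≤ 1`.
* ★★ `valleyGainLogAt_of_shellSmallLog : ScalesAdmissible L δ δ → InnerShellGainSmallLogAt L δc δ η → ValleyGainLogAt L δ η → ValleyGainLogAt L δc η`;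
* `valleyGainLogAt_pow_of_shellSmallLog` — polynomial radii `(β^{−s}, β^{−p})`, `0 < p < 1/3` (✓`scalesAdmissible_powScale`).
HONEST FRAMING: kernel-checked glue for W(L) of stub S-BASE of a child of the CONDITIONAL reduction route R2b1; both zone statements at general scales, W(L), the stubs and the
crux `TwistedTraceScaling` are OPEN; fixed lattice size, eventually in `β`; not infinite volume, not a mass gap, not Clay.  No definitions, no `sorry`.
(Build touch 2026-08-30T05:4xZ: declarations byte-identical to ✓p762571; docstring line only, to trigger the hub olean build.)
-/

set_option autoImplicit false

noncomputable section

open MeasureTheory Filter Topology Real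
open scoped BigOperators
open Literature.MathematicalPhysics.QuantumFieldTheory
open Literature.MathematicalPhysics.QuantumLattice

namespace Summit.QuantumFields.YangMills.Theorems.FemtoTransferGap

variable {L : ℕ} [NeZero L]

/-- Pure-real margin: for `0 ≤ λ ≤ 1` and `x·λ ≤ 1/2`, `λ/4 ≤ e^{−xλ} − e^{−(x+1)λ}` (`e^{−xλ} ≥ e^{−1/2} ≥ 1/2` and `1 − e^{−λ} ≥ λ/2`). [folklore] -/
theorem exp_rate_margin {x lam : ℝ} (hlam0 : 0 ≤ lam) (hlam1 : lam ≤ 1) (hx : x * lam ≤ 1 / 2) :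
    lam / 4 ≤ Real.exp (-(x * lam)) - Real.exp (-((x + 1) * lam)) := by
  have hA2 : (1 : ℝ) / 2 ≤ Real.exp (-(x * lam)) := by
    have h5 : Real.exp (-(1 / 2 : ℝ)) ≤ Real.exp (-(x * lam)) := Real.exp_le_exp.2 (by linarith)
    refine le_trans ?_ h5
    rw [Real.exp_neg, le_inv_comm₀ (by norm_num) (Real.exp_pos _)]
    have h6 : Real.exp (1 / 2 : ℝ) ≤ 2 := by
      have h7 : Real.exp (1 / 2 : ℝ) ^ 2 = Real.exp 1 := by rw [← Real.exp_nat_mul]; norm_num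
      nlinarith [Real.exp_one_lt_d9, Real.exp_pos (1 / 2 : ℝ)]
    simpa using h6
  have e1 : Real.exp (-((x + 1) * lam)) = Real.exp (-(x * lam)) * Real.exp (-lam) := by
    rw [← Real.exp_add]; congr 1; ring
  rw [e1, ← mul_one_sub]
  have h8 : lam / 2 ≤ 1 - Real.exp (-lam) := by
    have g1 : 1 + lam ≤ Real.exp lam := by have := Real.add_one_le_exp lam; linarith
    have g2 : 1 ≤ Real.exp lam * (1 - lam / 2) := by
      have : (1 : ℝ) ≤ (1 + lam) * (1 - lam / 2) := by nlinarith
      exact this.trans (mul_le_mul_of_nonneg_right g1 (by linarith))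
    have g3 : Real.exp (-lam) * Real.exp lam = 1 := by rw [← Real.exp_add]; simp
    have g4 := Real.exp_pos (-lam)
    nlinarith [mul_le_mul_of_nonneg_left g2 g4.le]
  have h9 : 0 ≤ 1 - Real.exp (-lam) := by linarith
  nlinarith

/-- A gain at log rate `c + 1` is below the rate `(c·log β + 1)·λ` once `log β ≥ 1` (`λ ≥ 0`). [folklore] -/
theorem exp_log_rate_succ_le {c β lam : ℝ} (hβ : Real.exp 1 ≤ β) (hlam : 0 ≤ lam) :
    Real.exp (-((c + 1) * Real.log β * lam)) ≤ Real.exp (-((c * Real.log β + 1) * lam)) := by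
  refine Real.exp_le_exp.2 ?_
  have hlog1 : 1 ≤ Real.log β := by
    have := Real.log_le_log (Real.exp_pos 1) hβ
    rwa [Real.log_exp] at this
  have e : (c + 1) * Real.log β * lam = (c * Real.log β + Real.log β) * lam := by ring
  rw [e]
  have := mul_le_mul_of_nonneg_right (show c * Real.log β + 1 ≤ c * Real.log β + Real.log β by linarith) hlam
  linarith

/-- ★★ **VALLEY GAIN WITH LOG RATE down to the core radius from the SMALL-ACTION SHELL GAIN + VALLEY GAIN (both with log rate) at the intermediate radius** (`ScalesAdmissible L δ δ`):
`InnerShellGainSmallLogAt L δc δ η → ValleyGainLogAt L δ η → ValleyGainLogAt L δc η` — as ✓`valleyGainAt_of_shellSmall`, with the rate `c·log β` carried through the IMS cut.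
[cite: Luscher1983, §3] [cite: SimonB1983DiscreteSpectrum, §3] -/
theorem valleyGainLogAt_of_shellSmallLog {δc δ η : ℝ → ℝ} (hS : ScalesAdmissible L δ δ) (hSh : InnerShellGainSmallLogAt L δc δ η) (hV : ValleyGainLogAt L δ η) :
    ValleyGainLogAt L δc η := by
  intro c
  obtain ⟨hδ, -, hErr⟩ := hS
  obtain ⟨βSh, hSh'⟩ := hSh (c + 1)
  obtain ⟨βV, hV'⟩ := hV (c + 1)
  obtain ⟨βE, hE⟩ := hErr (1 / 4) (by norm_num)
  obtain ⟨βl, hl⟩ := Filter.eventually_atTop.mp (TwoLattice.ConstTube.log_mul_bareLambda_le_of_pos (L := L) |c| (show (0 : ℝ) < 1 / 2 by norm_num))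
  refine ⟨max (max (Real.exp 1) βE) (max (max βSh βV) (max βl (2 / (1 : ℝ) ^ 3))), fun β hβ φ hφ hsupp => ?_⟩
  have hβe : Real.exp 1 ≤ β := ((le_max_left _ _).trans (le_max_left _ _)).trans hβ
  have hβ1 : 1 ≤ β := le_trans (by have := Real.add_one_le_exp (1 : ℝ); linarith) hβe
  have hβ0 : 0 < β := by linarith
  have hβE : βE ≤ β := ((le_max_right _ _).trans (le_max_left _ _)).trans hβ
  have hβSh : βSh ≤ β := (((le_max_left _ _).trans (le_max_left _ _)).trans (le_max_right _ _)).trans hβ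
  have hβV : βV ≤ β := (((le_max_right _ _).trans (le_max_left _ _)).trans (le_max_right _ _)).trans hβ
  have hβl : βl ≤ β := (((le_max_left _ _).trans (le_max_right _ _)).trans (le_max_right _ _)).trans hβ
  have hβτ : 2 / (1 : ℝ) ^ 3 ≤ β := (((le_max_right _ _).trans (le_max_right _ _)).trans (le_max_right _ _)).trans hβ
  set lam := bareLambda ((L : ℝ) ^ 3 * β) with hlam
  set A : ℝ := c * Real.log β with hAdef
  have hL1 : (1 : ℝ) ≤ (L : ℝ) ^ 3 := one_le_pow₀ (by exact_mod_cast NeZero.one_le)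
  have hB'0 : 0 < (L : ℝ) ^ 3 * β := by positivity
  have hlam0 : 0 < lam := bareLambda_pos' hB'0
  have hlam1 : lam ≤ 1 := bareLambda_cube_le (L := L) one_pos hβτ
  have hΛ0 : 0 < levelValue su2Rep L β 0 := levelValue_su2Rep_pos hβ0 0
  have hlog0 : 0 ≤ Real.log β := Real.log_nonneg hβ1
  -- `A·lam ≤ 1/2`
  have hAl : A * lam ≤ 1 / 2 := by
    have h2 : A * lam ≤ |c| * Real.log β * lam := by
      rw [hAdef]; exact mul_le_mul_of_nonneg_right (mul_le_mul_of_nonneg_right (le_abs_self c) hlog0) hlam0.le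
    exact h2.trans (hl β hβl)
  -- the margin `e^{−A lam} − e^{−(A+1) lam} ≥ lam/4`
  have hmargin : lam / 4 * levelValue su2Rep L β 0 ≤ (Real.exp (-(A * lam)) - Real.exp (-((A + 1) * lam))) * levelValue su2Rep L β 0 :=
    mul_le_mul_of_nonneg_right (exp_rate_margin hlam0.le hlam1 hAl) hΛ0.le
  -- the IMS error through the floor
  have herr : (1 / 2) * ((Fintype.card (Edge 3 L) : ℝ) ^ 2 * (8 * π / δ β) ^ 2 * (3 / β) * latCE L β) ≤ lam / 4 * levelValue su2Rep L β 0 := by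
    have h1 : (1 / 2) * ((Fintype.card (Edge 3 L) : ℝ) ^ 2 * (3 / β) * (8 * π / δ β) ^ 2) ≤ onionErr L β (δ β) (δ β) :=
      onionErr₂_delta_le_onionErr hβ0 (δ β) (δ β)
    have h2 := (h1.trans (hE β hβE))
    have hCE := (latCE_pos (L := L) hβ0.le).le
    have h3 := mul_le_mul_of_nonneg_right h2 hCE
    have h4 : 1 / 4 * bareLambda ((L : ℝ) ^ 3 * β) * uniformFloorConst L * latCE L β ≤ lam / 4 * levelValue su2Rep L β 0 := by
      have := mul_le_mul_of_nonneg_left (levelValue_zero_ge_uniform (L := L) hβ1) (by positivity : (0 : ℝ) ≤ 1 / 4 * lam)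
      rw [hlam] at this ⊢; linarith [this]
    calc (1 / 2) * ((Fintype.card (Edge 3 L) : ℝ) ^ 2 * (8 * π / δ β) ^ 2 * (3 / β) * latCE L β)
        = (1 / 2) * ((Fintype.card (Edge 3 L) : ℝ) ^ 2 * (3 / β) * (8 * π / δ β) ^ 2) * latCE L β := by ring
      _ ≤ _ := h3
      _ ≤ _ := h4
  -- the cut
  have hims := qform_le_inner_outer_lat hβ0 (hδ β) hφ
  have hcP : IsPhys fun U => Real.cos (innerPhase (δ β) U) * φ U := isPhys_inner (δ β) hφ
  have hsP : IsPhys fun U => Real.sin (innerPhase (δ β) U) * φ U := isPhys_outer (δ β) hφ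
  -- the cos-piece is in the small-action shell (action bound inherited from `φ`), at log rate `c + 1 ≥` rate `(A + 1)·lam`
  have hcos0 := hSh' β hβSh _ hcP fun U hU => by
    refine ⟨(hsupp U (right_ne_zero_of_mul hU)).1, exists_orbitDist_lt_of_cos_ne_zero (hδ β) (left_ne_zero_of_mul hU), ?_⟩
    exact (hsupp U (right_ne_zero_of_mul hU)).2
  have hrate := exp_log_rate_succ_le (c := c) hβe hlam0.le
  have hcos : qform su2Rep β (fun U => Real.cos (innerPhase (δ β) U) * φ U) (fun U => Real.cos (innerPhase (δ β) U) * φ U) ≤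
      Real.exp (-((A + 1) * lam)) * levelValue su2Rep L β 0 *
        l2 (fun U => Real.cos (innerPhase (δ β) U) * φ U) (fun U => Real.cos (innerPhase (δ β) U) * φ U) :=
    hcos0.trans (mul_le_mul_of_nonneg_right (mul_le_mul_of_nonneg_right hrate hΛ0.le) (l2_self_nonneg_lat _))
  -- the sin-piece is in the old valley
  have hsin0 := hV' β hβV _ hsP fun U hU =>
    ⟨(hsupp U (right_ne_zero_of_mul hU)).1, forall_lt_orbitDist_of_sin_ne_zero (hδ β) (left_ne_zero_of_mul hU)⟩
  have hsin : qform su2Rep β (fun U => Real.sin (innerPhase (δ β) U) * φ U) (fun U => Real.sin (innerPhase (δ β) U) * φ U) ≤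
      Real.exp (-((A + 1) * lam)) * levelValue su2Rep L β 0 *
        l2 (fun U => Real.sin (innerPhase (δ β) U) * φ U) (fun U => Real.sin (innerPhase (δ β) U) * φ U) :=
    hsin0.trans (mul_le_mul_of_nonneg_right (mul_le_mul_of_nonneg_right hrate hΛ0.le) (l2_self_nonneg_lat _))
  have hsplit := l2_cos_add_l2_sin (measurable_innerPhase (δ β)) hφ
  have hφ0 := l2_self_nonneg_lat φ
  -- assemble
  have h1 : qform su2Rep β φ φ ≤ Real.exp (-((A + 1) * lam)) * levelValue su2Rep L β 0 * l2 φ φ + lam / 4 * levelValue su2Rep L β 0 * l2 φ φ := by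
    have h2 := mul_le_mul_of_nonneg_right herr hφ0
    have h4 : Real.exp (-((A + 1) * lam)) * levelValue su2Rep L β 0 * l2 (fun U => Real.cos (innerPhase (δ β) U) * φ U) (fun U => Real.cos (innerPhase (δ β) U) * φ U)
        + Real.exp (-((A + 1) * lam)) * levelValue su2Rep L β 0 * l2 (fun U => Real.sin (innerPhase (δ β) U) * φ U) (fun U => Real.sin (innerPhase (δ β) U) * φ U)
        = Real.exp (-((A + 1) * lam)) * levelValue su2Rep L β 0 * l2 φ φ := by
      rw [← hsplit]; ring
    linarith [hims, hcos, hsin, h2, h4]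
  have h3 := mul_le_mul_of_nonneg_right hmargin hφ0
  linarith [h1, h3]

/-- Polynomial radii: `InnerShellGainSmallLogAt L (β^{−s}) (β^{−p}) (β^{−q}) → ValleyGainLogAt L (β^{−p}) (β^{−q}) → ValleyGainLogAt L (β^{−s}) (β^{−q})` (`0 < p < 1/3`).
[cite: Luscher1983, §3] -/
theorem valleyGainLogAt_pow_of_shellSmallLog {s p q : ℝ} (hp0 : 0 < p) (hp : p < 1 / 3)
    (hSh : InnerShellGainSmallLogAt L (powScale s) (powScale p) (powScale q)) (hV : ValleyGainLogAt L (powScale p) (powScale q)) :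
    ValleyGainLogAt L (powScale s) (powScale q) :=
  valleyGainLogAt_of_shellSmallLog (scalesAdmissible_powScale hp0 hp) hSh hV

end Summit.QuantumFields.YangMills.Theorems.FemtoTransferGap

end
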